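import Summits.QuantumAdvantage.AdviceFreeQNC0.AffBells37Slice
import HarnessLib

/-!
# AffBells37 (4/6) — (R) the RESONANCE MGF `Σ_a 2^{Zcount} ≤ 2ⁿ(3/2)^{Fn}` and the `ω^z / ⟨P,v⟩ / ι` algebra

Cell qa-qnc0, route DWalkThree (crux stmt-QuantumAdvantage-22907; rung (NP₁) `AffBells26.AffBellsPolyLoss3`).  AUTHORED AND PROVED BY THE PLANNER qa-qnc0-p2 gen 34 (memo `HOME/qa-qnc0-p2/ROUND-34P2.md`, INBOX P2-34a/b, 2026-08-29); landed verbatim by qn-prover-3.  Part 4/6 of the all-firsts PAIR-SLICING + `𝔽₄`-KRAFT proof of (NP₁); the six parts are a mechanical split (≤ 400 lines each) of one kernel-checked file `AffBells37.lean` (rc 0, 0 sorries, axioms propext/Classical.choice/Quot.sound).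

(R) `resonanceMGF`: for `σ, m ≠ 0` the test letter `m·rv_{gj}(a) + σ·path_{gj}(a)` depends on `a` only through `x_{3j+2}(a), x_{3j+3}(a)`
and `sg(a_{p_j})`; flipping the NON-free walk bits `u_{3j+1}` (`lpos`) and `u_{3j+3}` (`rpos`) moves `(x_{3j+2}, x_{3j+3})` through all four
sign patterns without touching any other test letter (`testRow_flipAt_of_ne`, `testRow_flip_l/r/lr`), and at most TWO of the four are resonant
(`no_three_resonant`, by `decide` over `(ℤ/3)^6`; `four_orbit_le`) — so each factor contributes `≤ (1+1+2+2)/4 = 3/2` (induction on `j`).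
Then the character algebra used by the slice expansion (part 5): `ωz`, `lin`, `chiZ_eq_ωz`, `ιF_xor`, `ιF_decide_eq_zero`
(`[D = 0] = Σ_k ω^{kD}`), `ιF_eq_omega` (`ι(b) = ω(1 + ω^{[b]})`), and the trace formula `ιF_ringWinU` for the walk win bit.
-/

noncomputable section

namespace Summit.QuantumAdvantage.AdviceFreeQNC0.AffBells37

open Finset F4
open Classical

section Slicing

open Literature.Computability.QuantumComplexity Literature.Computability.QuantumComplexity.RingHLF
open AffBells23 AffBells26

variable {F : ℕ} {ι : Type*} {n : ℕ}

/-! ### (R) The resonance MGF: flipping `u_{3j+1}` and `u_{3j+3}` -/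

/-- Flipping the walk coordinate `k`. -/
def flipAt (k : Fin n) (a : Fin n → Bool) : Fin n → Bool := Function.update a k (!a k)

/-- `flipAt k` is an involution. -/
theorem flipAt_flipAt (k : Fin n) (a : Fin n → Bool) : flipAt k (flipAt k a) = a := by
  funext i
  unfold flipAt
  by_cases h : i = k
  · subst h; simp
  · simp [Function.update_of_ne h]

/-- `flipAt k` does not change coordinates other than `k`. -/
theorem flipAt_apply_of_ne (k : Fin n) (a : Fin n → Bool) {i : Fin n} (h : i.val ≠ k.val) : flipAt k a i = a i := by
  unfold flipAt
  rw [Function.update_of_ne]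
  exact fun he => h (by rw [he])

/-- The extended input `uExt` is unchanged by `flipAt k` away from position `k`. -/
theorem uExt_flipAt_of_ne (k : Fin n) (a : Fin n → Bool) {m : ℕ} (hm : m ≠ k.val) :
    uExt (flipAt k a) m = uExt a m := by
  unfold uExt flipAt
  by_cases h : m < n
  · rw [dif_pos h, dif_pos h, Function.update_of_ne]
    intro he; apply hm; rw [← he]
  · rw [dif_neg h, dif_neg h]

/-- `flipAt k` negates the extended input at position `k`. -/
theorem uExt_flipAt_self (k : Fin n) (a : Fin n → Bool) : uExt (flipAt k a) k.val = !uExt a k.val := by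
  unfold uExt flipAt
  rw [dif_pos k.isLt, dif_pos k.isLt]
  simp

/-- A walk bit `x_i` with `i ∉ {k, k+1}` is unchanged by `flipAt k`. -/
theorem xOfU_flipAt_of_ne (k : Fin n) (a : Fin n → Bool) (i : Fin (n + 1)) (h1 : i.val ≠ k.val)
    (h2 : i.val ≠ k.val + 1) : xOfU (flipAt k a) i = xOfU a i := by
  unfold xOfU
  rw [uExt_flipAt_of_ne k a h1]
  by_cases h0 : i.val = 0
  · rw [if_pos h0, if_pos h0]
  · rw [if_neg h0, if_neg h0, uExt_flipAt_of_ne k a (show i.val - 1 ≠ k.val by omega)]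

/-- `flipAt k` negates the walk bit `x_k`. -/
theorem xOfU_flipAt_fst (k : Fin n) (a : Fin n → Bool) (i : Fin (n + 1)) (h : i.val = k.val) :
    xOfU (flipAt k a) i = !xOfU a i := by
  unfold xOfU
  rw [h, uExt_flipAt_self k a]
  by_cases h0 : k.val = 0
  · rw [if_pos h0, if_pos h0]; cases uExt a k.val <;> rfl
  · rw [if_neg h0, if_neg h0, uExt_flipAt_of_ne k a (show k.val - 1 ≠ k.val by omega)]
    cases uExt a k.val <;> cases uExt a (k.val - 1) <;> rfl

/-- `flipAt k` negates the walk bit `x_{k+1}`. -/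
theorem xOfU_flipAt_snd (k : Fin n) (a : Fin n → Bool) (i : Fin (n + 1)) (h : i.val = k.val + 1) :
    xOfU (flipAt k a) i = !xOfU a i := by
  unfold xOfU
  rw [uExt_flipAt_of_ne k a (show i.val ≠ k.val by omega), if_neg (show i.val ≠ 0 by omega),
    if_neg (show i.val ≠ 0 by omega), show i.val - 1 = k.val by omega, uExt_flipAt_self k a]
  cases uExt a i.val <;> cases uExt a k.val <;> rfl

/-- `sg (¬b) = − sg b`. -/
theorem sg_not (b : Bool) : sg (!b) = -sg b := by cases b <;> decide

/-- a flip away from the three coordinates `3x+1, 3x+2, 3x+3` read by factor `x` does not change it. -/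
theorem testRow_flipAt_of_ne (β : Fin (n + 1) → Fin (n + 1) → ZMod 3) (a : Fin n → Bool) (g : Fin (n + 1))
    (σ m : ZMod 3) (k : Fin n) (x : Fin (Fn n)) (hA1 : 3 * x.val + 2 ≠ k.val) (hA2 : 3 * x.val + 2 ≠ k.val + 1)
    (hB1 : 3 * x.val + 3 ≠ k.val) (hB2 : 3 * x.val + 3 ≠ k.val + 1) :
    testRow β (flipAt k a) g σ m x = testRow β a g σ m x := by
  unfold testRow rv pathRow
  rw [xOfU_flipAt_of_ne k a (xposA x) hA1 hA2, xOfU_flipAt_of_ne k a (xposB x) hB1 hB2,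
    flipAt_apply_of_ne k a (i := fpos x) hA1]

/-- Effect of the left orbit flip `3j+1` on letter `j` of a test row: the `x_{3j+2}` sign is negated. -/
theorem testRow_flip_l (β : Fin (n + 1) → Fin (n + 1) → ZMod 3) (a : Fin n → Bool) (g : Fin (n + 1))
    (σ m : ZMod 3) (j : Fin (Fn n)) :
    testRow β (flipAt (lpos j) a) g σ m j
      = m * (β g (xposA j) * -sg (xOfU a (xposA j)) + β g (xposB j) * sg (xOfU a (xposB j))) + pathRow a g σ j := by
  unfold testRow rv pathRow
  rw [xOfU_flipAt_snd (lpos j) a (xposA j) (by simp [lpos, xposA]),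
    xOfU_flipAt_of_ne (lpos j) a (xposB j) (by simp [lpos, xposB]) (by simp [lpos, xposB]),
    flipAt_apply_of_ne (lpos j) a (i := fpos j) (by simp [lpos, fpos]), sg_not]

/-- Effect of the right orbit flip `3j+3` on letter `j` of a test row: the `x_{3j+3}` sign is negated. -/
theorem testRow_flip_r (β : Fin (n + 1) → Fin (n + 1) → ZMod 3) (a : Fin n → Bool) (g : Fin (n + 1))
    (σ m : ZMod 3) (j : Fin (Fn n)) :
    testRow β (flipAt (rpos j) a) g σ m j
      = m * (β g (xposA j) * sg (xOfU a (xposA j)) + β g (xposB j) * -sg (xOfU a (xposB j))) + pathRow a g σ j := by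
  unfold testRow rv pathRow
  rw [xOfU_flipAt_of_ne (rpos j) a (xposA j) (by simp [rpos, xposA]) (by simp [rpos, xposA]),
    xOfU_flipAt_fst (rpos j) a (xposB j) (by simp [rpos, xposB]),
    flipAt_apply_of_ne (rpos j) a (i := fpos j) (by simp [rpos, fpos]), sg_not]

/-- Effect of both orbit flips on letter `j` of a test row: both signs are negated. -/
theorem testRow_flip_lr (β : Fin (n + 1) → Fin (n + 1) → ZMod 3) (a : Fin n → Bool) (g : Fin (n + 1))
    (σ m : ZMod 3) (j : Fin (Fn n)) :
    testRow β (flipAt (lpos j) (flipAt (rpos j) a)) g σ m j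
      = m * (β g (xposA j) * -sg (xOfU a (xposA j)) + β g (xposB j) * -sg (xOfU a (xposB j))) + pathRow a g σ j := by
  rw [testRow_flip_l]
  unfold pathRow
  rw [xOfU_flipAt_of_ne (rpos j) a (xposA j) (by simp [rpos, xposA]) (by simp [rpos, xposA]),
    xOfU_flipAt_fst (rpos j) a (xposB j) (by simp [rpos, xposB]),
    flipAt_apply_of_ne (rpos j) a (i := fpos j) (by simp [rpos, fpos]), sg_not]

/-- Every letter of a path row with `σ ≠ 0` is nonzero. -/
theorem pathRow_ne_zero (a : Fin n → Bool) (g : Fin (n + 1)) {σ : ZMod 3} (hσ : σ ≠ 0) (j : Fin (Fn n)) :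
    pathRow a g σ j ≠ 0 := by
  unfold pathRow
  have h1 := sg_ne_zero (a (fpos j))
  have h3 : ∀ x y z : ZMod 3, x ≠ 0 → y ≠ 0 → (z = 1 ∨ z = 2) → x * (y * z) ≠ 0 := by decide
  exact h3 σ _ _ hσ h1 (by split_ifs <;> simp)

set_option synthInstance.maxHeartbeats 400000 in
set_option synthInstance.maxSize 4096 in
/-- the resonance count: on a Klein-four orbit at most two of the four sign patterns resonate. -/
theorem no_three_resonant : ∀ (m βA βB π sA sB : ZMod 3), m ≠ 0 → π ≠ 0 → sA ≠ 0 → sB ≠ 0 →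
    ¬ (m * (βA * sA + βB * sB) + π = 0 ∧ m * (βA * -sA + βB * sB) + π = 0 ∧ m * (βA * sA + βB * -sB) + π = 0) ∧
    ¬ (m * (βA * sA + βB * sB) + π = 0 ∧ m * (βA * -sA + βB * sB) + π = 0 ∧ m * (βA * -sA + βB * -sB) + π = 0) ∧
    ¬ (m * (βA * sA + βB * sB) + π = 0 ∧ m * (βA * sA + βB * -sB) + π = 0 ∧ m * (βA * -sA + βB * -sB) + π = 0) ∧
    ¬ (m * (βA * -sA + βB * sB) + π = 0 ∧ m * (βA * sA + βB * -sB) + π = 0 ∧ m * (βA * -sA + βB * -sB) + π = 0) := by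
  decide

/-- Klein-four resonance count: if no three of four decidable events hold simultaneously, `Σ (if P_i then 2 else 1) ≤ 6`. -/
private theorem four_orbit_le {P1 P2 P3 P4 : Prop} [Decidable P1] [Decidable P2] [Decidable P3] [Decidable P4]
    (h : ¬ (P1 ∧ P2 ∧ P3) ∧ ¬ (P1 ∧ P2 ∧ P4) ∧ ¬ (P1 ∧ P3 ∧ P4) ∧ ¬ (P2 ∧ P3 ∧ P4)) :
    (if P1 then (2 : ℝ) else 1) + (if P2 then (2 : ℝ) else 1) + (if P3 then (2 : ℝ) else 1)
      + (if P4 then (2 : ℝ) else 1) ≤ 6 := by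
  obtain ⟨n123, n124, n134, n234⟩ := h
  by_cases h1 : P1 <;> by_cases h2 : P2 <;> by_cases h3 : P3 <;> by_cases h4 : P4
  · exact absurd ⟨h1, h2, h3⟩ n123
  · exact absurd ⟨h1, h2, h3⟩ n123
  · exact absurd ⟨h1, h2, h4⟩ n124
  · norm_num [h1, h2, h3, h4]
  · exact absurd ⟨h1, h3, h4⟩ n134
  · norm_num [h1, h2, h3, h4]
  · norm_num [h1, h2, h3, h4]
  · norm_num [h1, h2, h3, h4]
  · exact absurd ⟨h2, h3, h4⟩ n234
  · norm_num [h1, h2, h3, h4]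
  · norm_num [h1, h2, h3, h4]
  · norm_num [h1, h2, h3, h4]
  · norm_num [h1, h2, h3, h4]
  · norm_num [h1, h2, h3, h4]
  · norm_num [h1, h2, h3, h4]
  · norm_num [h1, h2, h3, h4]

/-- **(R)** the resonance MGF. -/
theorem resonanceMGF : ResonanceMGF := by
  intro n β g σ m hσ hm
  have hprod : ∀ a : Fin n → Bool, (2 : ℝ) ^ Zcount β a g σ m
      = ∏ j : Fin (Fn n), (if testRow β a g σ m j = 0 then (2 : ℝ) else 1) := by
    intro a
    unfold Zcount
    rw [prod_ite, prod_const, prod_const_one, mul_one]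
  simp_rw [hprod]
  suffices h : ∀ F : Finset (Fin (Fn n)),
      ∑ a : Fin n → Bool, ∏ j ∈ F, (if testRow β a g σ m j = 0 then (2 : ℝ) else 1)
        ≤ (2 : ℝ) ^ n * (3 / 2 : ℝ) ^ F.card by
    have := h univ
    rwa [card_univ, Fintype.card_fin] at this
  intro F
  induction F using Finset.induction_on with
  | empty => simp [Fintype.card_bool, Fintype.card_fin]
  | insert j s hjs ih =>
    rw [card_insert_of_notMem hjs, pow_succ]
    simp_rw [prod_insert hjs]
    set f : (Fin n → Bool) → ℝ := fun a => ∏ x ∈ s, (if testRow β a g σ m x = 0 then (2 : ℝ) else 1) with hf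
    set gj : (Fin n → Bool) → ℝ := fun a => (if testRow β a g σ m j = 0 then (2 : ℝ) else 1) with hgj
    set φ1 : (Fin n → Bool) → (Fin n → Bool) := flipAt (lpos j) with hφ1
    set φ2 : (Fin n → Bool) → (Fin n → Bool) := flipAt (rpos j) with hφ2
    have hφ1i : Function.Involutive φ1 := fun a => flipAt_flipAt (lpos j) a
    have hφ2i : Function.Involutive φ2 := fun a => flipAt_flipAt (rpos j) a
    have hf1 : ∀ a, f (φ1 a) = f a := by
      intro a
      simp only [hf, hφ1]
      refine prod_congr rfl fun x hx => ?_
      have hxj : x ≠ j := fun h => hjs (h ▸ hx)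
      have hxj' : x.val ≠ j.val := fun h => hxj (Fin.ext h)
      rw [testRow_flipAt_of_ne β a g σ m (lpos j) x (by simp [lpos]; omega) (by simp [lpos]; omega)
        (by simp [lpos]; omega) (by simp [lpos]; omega)]
    have hf2 : ∀ a, f (φ2 a) = f a := by
      intro a
      simp only [hf, hφ2]
      refine prod_congr rfl fun x hx => ?_
      have hxj : x ≠ j := fun h => hjs (h ▸ hx)
      have hxj' : x.val ≠ j.val := fun h => hxj (Fin.ext h)
      rw [testRow_flipAt_of_ne β a g σ m (rpos j) x (by simp [rpos]; omega) (by simp [rpos]; omega)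
        (by simp [rpos]; omega) (by simp [rpos]; omega)]
    have hfnn : ∀ a, 0 ≤ f a := by
      intro a; simp only [hf]
      exact prod_nonneg fun x _ => by split_ifs <;> norm_num
    have hg4 : ∀ a, gj a + gj (φ1 a) + gj (φ2 a) + gj (φ1 (φ2 a)) ≤ 6 := by
      intro a
      simp only [hgj, hφ1, hφ2]
      rw [testRow_flip_l, testRow_flip_r, testRow_flip_lr]
      unfold testRow rv
      exact four_orbit_le (no_three_resonant m (β g (xposA j)) (β g (xposB j)) (pathRow a g σ j)
        (sg (xOfU a (xposA j))) (sg (xOfU a (xposB j))) hm (pathRow_ne_zero a g hσ j) (sg_ne_zero _) (sg_ne_zero _))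
    have hs1 : ∑ a, gj (φ1 a) * f a = ∑ a, gj a * f a := by
      calc ∑ a, gj (φ1 a) * f a = ∑ a, gj (φ1 a) * f (φ1 a) := by simp_rw [hf1]
        _ = ∑ a, gj a * f a := Equiv.sum_comp (hφ1i.toPerm φ1) (fun a => gj a * f a)
    have hs2 : ∑ a, gj (φ2 a) * f a = ∑ a, gj a * f a := by
      calc ∑ a, gj (φ2 a) * f a = ∑ a, gj (φ2 a) * f (φ2 a) := by simp_rw [hf2]
        _ = ∑ a, gj a * f a := Equiv.sum_comp (hφ2i.toPerm φ2) (fun a => gj a * f a)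
    have hs12 : ∑ a, gj (φ1 (φ2 a)) * f a = ∑ a, gj a * f a := by
      calc ∑ a, gj (φ1 (φ2 a)) * f a = ∑ a, gj (φ1 (φ2 a)) * f (φ1 (φ2 a)) := by simp_rw [hf1, hf2]
        _ = ∑ a, gj (φ1 a) * f (φ1 a) := Equiv.sum_comp (hφ2i.toPerm φ2) (fun a => gj (φ1 a) * f (φ1 a))
        _ = ∑ a, gj a * f a := Equiv.sum_comp (hφ1i.toPerm φ1) (fun a => gj a * f a)
    have h4 : 4 * ∑ a, gj a * f a ≤ 6 * ∑ a, f a := by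
      calc 4 * ∑ a, gj a * f a
          = ∑ a, gj a * f a + ∑ a, gj (φ1 a) * f a + ∑ a, gj (φ2 a) * f a + ∑ a, gj (φ1 (φ2 a)) * f a := by
            rw [hs1, hs2, hs12]; ring
        _ = ∑ a, (gj a + gj (φ1 a) + gj (φ2 a) + gj (φ1 (φ2 a))) * f a := by
            simp only [← sum_add_distrib, add_mul]
        _ ≤ ∑ a, 6 * f a := sum_le_sum fun a _ => mul_le_mul_of_nonneg_right (hg4 a) (hfnn a)
        _ = 6 * ∑ a, f a := by rw [mul_sum]
    have hmain : ∑ a, gj a * f a ≤ (2 : ℝ) ^ n * ((3 / 2 : ℝ) ^ s.card * (3 / 2)) := by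
      have h2 : (0 : ℝ) ≤ (2 : ℝ) ^ n * (3 / 2 : ℝ) ^ s.card := by positivity
      nlinarith [h4, ih, h2]
    simpa [hgj, hf] using hmain

/-! ### (E) The slice expansion — algebra of `ωz`, `lin`, `ιF` -/

/-- `ωz 0 = 1`. -/
theorem ωz_zero : ωz 0 = 1 := by unfold ωz; rw [ZMod.val_zero, pow_zero]

/-- `ωz` is multiplicative: `ωz (x+y) = ωz x · ωz y`. -/
theorem ωz_add (x y : ZMod 3) : ωz (x + y) = ωz x * ωz y := by
  unfold ωz
  rw [ZMod.val_add, ← omega_pow_mod, pow_add]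

/-- `ωz` of a natural-number cast is the corresponding power of `ω`. -/
theorem ωz_natCast (N : ℕ) : ωz (N : ZMod 3) = ω ^ N := by
  unfold ωz
  rw [ZMod.val_natCast, ← omega_pow_mod]

/-- `(ωz x)² = ωz (2x)`. -/
theorem ωz_sq (x : ZMod 3) : ωz x ^ 2 = ωz (2 * x) := by
  rw [two_mul, ωz_add, sq]

/-- `ωz` turns finite sums into products. -/
theorem ωz_sum {κ : Type*} (s : Finset κ) (f : κ → ZMod 3) : ωz (∑ i ∈ s, f i) = ∏ i ∈ s, ωz (f i) := by
  induction s using Finset.induction_on with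
  | empty => rw [sum_empty, prod_empty, ωz_zero]
  | insert a s ha ih => rw [sum_insert ha, prod_insert ha, ωz_add, ih]

/-- the linear functional `⟨P, v⟩ = Σ_{v_j} P_j`. -/
def lin {F : ℕ} (P : Fin F → ZMod 3) (v : Fin F → Bool) : ZMod 3 := ∑ j, if v j then P j else 0

/-- A cube-restricted character is `ωz` of the linear form `lin`. -/
theorem chiZ_eq_ωz {F : ℕ} (P : Fin F → ZMod 3) (v : Fin F → Bool) : chiZ P v = ωz (lin P v) := by
  unfold chiZ expo lin
  rw [ωz_sum, ← prod_pow_eq_pow_sum]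
  refine prod_congr rfl fun j _ => ?_
  by_cases h : v j
  · rw [if_pos h, if_pos h]; rfl
  · rw [if_neg h, if_neg h, pow_zero, ωz_zero]

/-- `lin` is additive in the row. -/
theorem lin_add {F : ℕ} (P Q : Fin F → ZMod 3) (v : Fin F → Bool) : lin (P + Q) v = lin P v + lin Q v := by
  unfold lin
  rw [← sum_add_distrib]
  refine sum_congr rfl fun j _ => ?_
  by_cases h : v j
  · rw [if_pos h, if_pos h, if_pos h, Pi.add_apply]
  · rw [if_neg h, if_neg h, if_neg h, add_zero]

/-- `lin` is homogeneous in the row. -/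
theorem lin_mul {F : ℕ} (k : ZMod 3) (P : Fin F → ZMod 3) (v : Fin F → Bool) :
    lin (fun j => k * P j) v = k * lin P v := by
  unfold lin
  rw [mul_sum]
  refine sum_congr rfl fun j _ => ?_
  by_cases h : v j
  · rw [if_pos h, if_pos h]
  · rw [if_neg h, if_neg h, mul_zero]

/-- `lin` of a unit row is the indicator of the coordinate. -/
theorem lin_single {F : ℕ} (j : Fin F) (v : Fin F → Bool) :
    lin (Pi.single j (1 : ZMod 3)) v = if v j then 1 else 0 := by
  unfold lin
  rw [Finset.sum_eq_single j]
  · rw [Pi.single_eq_same]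
  · intro i _ hij
    rw [Pi.single_eq_of_ne hij]
    split_ifs <;> rfl
  · intro h; exact absurd (mem_univ j) h

/-- `lin` depends only on the values of the row. -/
theorem lin_congr_fun {F : ℕ} {P Q : Fin F → ZMod 3} (h : ∀ j, P j = Q j) (v : Fin F → Bool) : lin P v = lin Q v := by
  unfold lin
  exact sum_congr rfl fun j _ => by rw [h j]

/-- `ιF` turns `xor` into addition in `F4`. -/
theorem ιF_xor (b b' : Bool) : ιF (xor b b') = ιF b + ιF b' := by
  cases b <;> cases b' <;> simp [ιF, F4.add_self]

/-- `ιF (¬b) = 1 + ιF b`. -/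
theorem ιF_not (b : Bool) : ιF (!b) = 1 + ιF b := by
  cases b <;> simp [ιF, F4.add_self]

/-- `ιF` of the parity bit of `m` is the cast of `m` into `F4`. -/
theorem ιF_decide_odd (m : ℕ) : ιF (decide (m % 2 = 1)) = (m : F4) := by
  rw [natCast_eq]
  by_cases h : m % 2 = 1
  · simp [h, ιF]
  · simp [h, ιF]

/-- `ωz 1 = ω`. -/
theorem ωz_one : ωz 1 = ω := by unfold ωz; rw [show (1 : ZMod 3).val = 1 from rfl, pow_one]

/-- `ωz 2 = ω²`. -/
theorem ωz_two : ωz 2 = ω ^ 2 := by unfold ωz; rw [show (2 : ZMod 3).val = 2 from rfl]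

/-- Case split on an element of `ZMod 3`. -/
private theorem zmod3_cases (D : ZMod 3) : D = 0 ∨ D = 1 ∨ D = 2 := by
  fin_cases D
  · exact Or.inl rfl
  · exact Or.inr (Or.inl rfl)
  · exact Or.inr (Or.inr rfl)

/-- the bell indicator is the average of the three characters: `[D = 0] = Σ_k ω^{kD}`. -/
theorem ιF_decide_eq_zero (D : ZMod 3) :
    ιF (decide (D = 0)) = ∑ k : Fin 3, ωz (((k.val : ℕ) : ZMod 3) * D) := by
  rw [Fin.sum_univ_three]
  simp only [Fin.val_zero, Fin.val_one, Fin.val_two, Nat.cast_zero, Nat.cast_one, Nat.cast_ofNat, zero_mul,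
    one_mul, ωz_zero]
  rcases zmod3_cases D with rfl | rfl | rfl
  · rw [mul_zero, ωz_zero]
    simp only [decide_true, ιF, if_true]
    rw [F4.add_self, zero_add]
  · rw [mul_one, ωz_one, ωz_two, add_assoc, omega_add_omega_sq, F4.add_self]
    simp [ιF]
  · rw [ωz_two, show (2 : ZMod 3) * 2 = 1 from rfl, ωz_one, add_assoc, add_comm (ω ^ 2) ω,
      omega_add_omega_sq, F4.add_self]
    simp [ιF, show (2 : ZMod 3) ≠ 0 by decide]

/-- the slice bit as a character: `ι(v_j) = ω + ω·ω^{[v_j]}`. -/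
theorem ιF_eq_omega (b : Bool) : ιF b = ω * (1 + ωz (if b then 1 else 0)) := by
  cases b
  · simp only [ιF, Bool.false_eq_true, if_false, ωz_zero]
    rw [F4.add_self, mul_zero]
  · simp only [ιF, if_true, ωz_one, mul_add, mul_one]
    rw [← sq, omega_add_omega_sq]

/-- the trace formula for the walk-coordinate win bit. -/
theorem ιF_ringWinU (cc : ℕ) (y : Fin (n + 1) → (Fin n → Bool) → Bool) (u : Fin n → Bool) :
    ιF (ringWinU cc y u) = ∑ g : Fin (n + 1), ιF (y g u) * tr (ω ^ (cc + g.val + walkExp u g.val)) := by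
  unfold ringWinU
  rw [ιF_decide_odd, Finset.natCast_card_filter]
  refine sum_congr rfl fun g _ => ?_
  rw [tr_omega_pow]
  unfold ιF
  by_cases h1 : y g u = true
  · by_cases h2 : (cc + g.val + walkExp u g.val) % 3 = 0
    · simp [h1, h2]
    · simp [h1, h2]
  · simp [h1]

end Slicing

end Summit.QuantumAdvantage.AdviceFreeQNC0.AffBells37
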